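import Summits.BirchSwinnertonDyer.BirchSwinnertonDyer.Theses.ResidualThetaTransportAtTwo
import HarnessLib

/-!
# Route `ResidualThetaTransportAtTwo` (rung W-ALL/1.hab⁺): the join `Assembly`

The route's assembly item (stmt-BirchSwinnertonDyer-20691)
`Summit.BirchSwinnertonDyer.BirchSwinnertonDyer.Theses.ResidualThetaTransportAtTwo.Assembly :=
  ModularParametrizationSupply → EntireLFunctionRat → RankEqAnalyticRankLeOne →
    HeckeThetaPartnerAdicAtTwo → SignedMuVanishingAtTwoPlus → ThetaLayerLambdaCongruenceAtTwo →
    ResidualThetaMainConjectureAtTwo → SignedKatoDivisibilityUpToAtTwo → SignedControlAtTwo →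
    Summit.BirchSwinnertonDyer.WAllNonCMAtTwoThetaHabitatPlus`
is, literally, the type of the route's planner-authored deciding theorem `closes` (D-0027 §2.1,
proved in the route file with the standard axioms): for `W` on the habitat⁺ take the 2-adic Hecke
theta partner `(M, g, ι, Ω)` from K0⁺, an admissible odd `S₀`, and run Kμ⁺/Kan⁺/Kλ⁺/K3/K4 through
the X1 `μ/λ` algebra into `KobayashiMainConjecture W 2 1` and the tree door
`bsdp_two_of_kobayashiMainConjecture_two_of_frobeniusTrace_eq_zero`. Nothing is asserted here:
the nine items stay hypotheses of `Assembly` itself; this file is ONE application of `closes`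
(vet bsd-vet-tp2r g0, evidence `Proof.lean` 66b7be7cd299d57e on the item). BSD is not proved by
this. [cite: Kobayashi2003, Thm 1.3]
-/

set_option autoImplicit false
set_option linter.dupNamespace false

namespace Summit.BirchSwinnertonDyer.BirchSwinnertonDyer.Theorems

open Summit.BirchSwinnertonDyer.BirchSwinnertonDyer.Theses.ResidualThetaTransportAtTwo

/-- **The join of route `ResidualThetaTransportAtTwo` holds**: the three print supports
(modular parametrisation, entire `L`, Gross–Zagier–Kolyvagin), the 2-adic Hecke theta partner
K0⁺, signed `μ = 0` Kμ⁺, the layer `λ`-congruence Kan⁺, the residual theta main conjecture Kλ⁺,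
Kato's signed divisibility up to a 2-power K3 and signed control K4 imply the rung leaf
`WAllNonCMAtTwoThetaHabitatPlus` — by the route's deciding theorem `closes`, whose type this is.
[cite: Kobayashi2003, Thm 1.3] -/
theorem residualThetaTransportAtTwo_assembly_proof :
    Summit.BirchSwinnertonDyer.BirchSwinnertonDyer.Theses.ResidualThetaTransportAtTwo.Assembly := by
  unfold Summit.BirchSwinnertonDyer.BirchSwinnertonDyer.Theses.ResidualThetaTransportAtTwo.Assembly
  -- (buildfix 2026-08-28) The route's `closes` was re-keyed (rev 2026-08-28T00:4xZ) to PUB binders / twin items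
  -- (Ribet supply, K0⁺-of-Ribet, Greenberg-control inputs, K4-of-PUB) from which it first DERIVES K0⁺ and K4; the
  -- accepted `Assembly` statement takes K0⁺ (`HeckeThetaPartnerAdicAtTwo`) and K4 (`SignedControlAtTwo`) directly,
  -- so the remainder of the chain of `closes` is inlined here verbatim.
  intro hmod hLrat hGZK hP hmu han hlam hKato hStr W _ _ hcm hr hss ha hΔ
  have hL : W.entireLFunction 1 ≠ 0 := (W.analyticRank_eq_zero_iff_holds (hLrat W)).mp hr
  -- the 2-adic Hecke theta partner of W
  obtain ⟨M, iM, g, ι, Ω, hodd, hnew, hcmg, ha2g, hΩ, hcong⟩ := hP W hcm hr hss ha hΔ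
  obtain ⟨hmuAlg, hmuAn⟩ := hmu W hcm hr hss ha hΔ
  -- an admissible S₀: the places above the odd prime factors of N_W · M (PROVED)
  obtain ⟨S₀, hS₀2, hS₀W, hS₀M⟩ : ∃ S₀ : Finset (IsDedekindDomain.HeightOneSpectrum (NumberField.RingOfIntegers ℚ)),
      (∀ v ∈ S₀, ((2 : ℕ) : NumberField.RingOfIntegers ℚ) ∉ v.asIdeal) ∧
      (∀ v : IsDedekindDomain.HeightOneSpectrum (NumberField.RingOfIntegers ℚ), ¬ W.HasGoodReductionAt v → v ∈ S₀) ∧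
      (∀ v : IsDedekindDomain.HeightOneSpectrum (NumberField.RingOfIntegers ℚ), Rat.HeightOneSpectrum.natGenerator v ∣ M → v ∈ S₀) := by
    set S : Finset ℕ := (W.conductorNorm ℤ).primeFactors ∪ M.primeFactors with hS_def
    have hS : ∀ ℓ ∈ S, ℓ.Prime := by
      intro ℓ hℓ
      rcases Finset.mem_union.mp hℓ with h | h <;> exact Nat.prime_of_mem_primeFactors h
    obtain ⟨S₀, hS₀⟩ := Summit.BirchSwinnertonDyer.BirchSwinnertonDyer.Theorems.MultTransportAtTwo.exists_oddPlaces S hS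
    refine ⟨S₀, Summit.BirchSwinnertonDyer.BirchSwinnertonDyer.Theorems.MultTransportAtTwo.two_notMem_of_mem_oddPlaces S₀ hS₀,
      fun v hv ↦ ?_, fun v hv ↦ ?_⟩
    · by_contra hvS
      by_cases h2 : ((2 : ℕ) : NumberField.RingOfIntegers ℚ) ∈ v.asIdeal
      · exact hv (Summit.BirchSwinnertonDyer.BirchSwinnertonDyer.Theorems.SignedTransportAtTwo.hasGoodReductionAt_of_two_mem W hss.1 v h2)
      · exact hv (Summit.BirchSwinnertonDyer.BirchSwinnertonDyer.Theorems.MultTransportAtTwo.hasGoodReductionAt_of_notMem_oddPlaces S₀ hS₀ W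
          Finset.subset_union_left v hvS h2)
    · rw [hS₀ v]
      have hM0 : M ≠ 0 := NeZero.ne M
      refine ⟨Finset.mem_union_right _ (Nat.mem_primeFactors.2 ⟨Rat.HeightOneSpectrum.prime_natGenerator v, hv, hM0⟩), ?_⟩
      intro h2
      apply Nat.not_even_iff_odd.2 hodd
      exact even_iff_two_dvd.2 (h2 ▸ hv)
  -- Kobayashi's `+` main conjecture for W at 2
  have hMC : Summit.BirchSwinnertonDyer.Rank1Residual.Supersingular.KobayashiMainConjecture W 2 1 := by
    intro κ γ hκ hγ hcv _ f hf ϖ hϖ Lplus Lminus hPP D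
    haveI : Module.Finite (Literature.NumberTheory.EllipticCurves.IwasawaAlgebra 2) D.X := (hStr W hcm hr hss ha).1 κ γ hκ hγ D
    obtain ⟨hX, hμD⟩ := hmuAlg κ γ hκ hγ D
    refine ⟨hX, ?_⟩
    -- Kato's divisibility for W up to 2^m (K3)
    obtain ⟨g₁, h, m, hchar, hgh⟩ := hKato W hcm hr hss ha κ γ hκ hγ hcv f hf ϖ hϖ Lplus Lminus hPP D
    set ιΛ := Literature.NumberTheory.EllipticCurves.iwasawaToPowerSeries 2 with hιΛ
    set L := Summit.BirchSwinnertonDyer.Rank1Residual.Supersingular.kobayashiL (1 : ℤˣ) Lplus Lminus with hLdef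
    have hL0 : PowerSeries.C (ϖ : ℚ_[2]) * ιΛ L ≠ 0 :=
      Summit.BirchSwinnertonDyer.BirchSwinnertonDyer.Theorems.SignedTransportAtTwo.C_mul_iota_ne_zero hf hϖ hPP
    have hgh0 : g₁ * h ≠ 0 := by
      intro h0
      apply Summit.BirchSwinnertonDyer.BirchSwinnertonDyer.Theorems.SignedTransportAtTwo.C_pow_mul_ne_zero m hL0
      rw [← hgh, h0, map_zero]
    have hg0 : g₁ ≠ 0 := left_ne_zero_of_mul hgh0
    have hh0 : h ≠ 0 := right_ne_zero_of_mul hgh0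
    -- Kμ⁺ analytic: μ(g₁ h) = m ; Kμ⁺ algebraic: μ(X) = 0
    have hμG : Summit.BirchSwinnertonDyer.Rank1Residual.X1.MuLambda.mu (g₁ * h) = m :=
      hmuAn γ hcv f hf ϖ hϖ Lplus Lminus hPP (g₁ * h) m hgh
    -- Kan⁺ and Kλ⁺ at a common large layer: λ(X) = λ(g₁ h)
    obtain ⟨n₁, hn₁⟩ := han W hcm hr hss ha hΔ M g ι Ω hodd hnew hcmg ha2g hΩ.isPlusPeriod hcong f hf S₀ hS₀2 hS₀W hS₀M
    obtain ⟨n₂, hn₂⟩ := hlam W hcm hr hss ha hΔ M g ι Ω hodd hnew hcmg ha2g hΩ.isPlusPeriod hcong κ γ hκ hγ hcv f hf ϖ hϖ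
      Lplus Lminus hPP S₀ hS₀2 hS₀W hS₀M D hX hμD (g₁ * h) m hgh
    have h1 := hn₁ (2 * max n₁ n₂) (by omega) (even_two_mul _)
    have h2 := hn₂ (2 * max n₁ n₂) (by omega) (even_two_mul _)
    rw [h1, sub_self, sub_eq_zero] at h2
    have hlamG : Summit.BirchSwinnertonDyer.Rank1Residual.X1.MuLambda.lam (g₁ * h) =
        Literature.NumberTheory.EllipticCurves.lambdaInvariant 2 D.X := by exact_mod_cast h2.symm
    -- generator lemmas
    have hμg : Summit.BirchSwinnertonDyer.Rank1Residual.X1.MuLambda.mu g₁ = 0 := by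
      rw [Summit.BirchSwinnertonDyer.Rank1Residual.X1.MuPart.mu_generator_eq_muInvariant D.X hX hg0 hchar]
      exact hμD
    have hlamg : Summit.BirchSwinnertonDyer.Rank1Residual.X1.MuLambda.lam g₁ =
        Literature.NumberTheory.EllipticCurves.lambdaInvariant 2 D.X :=
      Summit.BirchSwinnertonDyer.Rank1Residual.X1.ParitySqueeze.lam_generator_eq_lambdaInvariant D.X hX hg0 hchar
    -- bookkeeping: μ(h) = m, λ(h) = 0
    rw [Summit.BirchSwinnertonDyer.Rank1Residual.X1.MuLambda.mu_mul hg0 hh0, hμg] at hμG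
    rw [Summit.BirchSwinnertonDyer.Rank1Residual.X1.MuLambda.lam_mul hg0 hh0, hlamg] at hlamG
    have hμh : Summit.BirchSwinnertonDyer.Rank1Residual.X1.MuLambda.mu h = m := by omega
    have hlamh : Summit.BirchSwinnertonDyer.Rank1Residual.X1.MuLambda.lam h = 0 := by omega
    -- h = 2^m · unit, and (g₁·u) is the Néron-normalised generator
    obtain ⟨u, hu⟩ := Summit.BirchSwinnertonDyer.BirchSwinnertonDyer.Theorems.SignedTransportAtTwo.exists_unit_of_mu_of_lam hh0 hμh hlamh
    have h2m : (PowerSeries.C ((2 : ℚ_[2]) ^ m) : PowerSeries ℚ_[2]) ≠ 0 :=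
      (map_ne_zero_iff _ PowerSeries.C_injective).mpr (pow_ne_zero m two_ne_zero)
    have hιh : ιΛ h = PowerSeries.C ((2 : ℚ_[2]) ^ m) * ιΛ (u : Literature.NumberTheory.EllipticCurves.IwasawaAlgebra 2) := by
      rw [hu, map_mul, hιΛ, Literature.NumberTheory.EllipticCurves.iwasawaToPowerSeries, PowerSeries.map_C, map_pow, map_ofNat]
    refine ⟨g₁ * u, ?_, ?_⟩
    · rw [hchar]; exact (Ideal.span_singleton_mul_right_unit u.isUnit g₁).symm
    · have key : PowerSeries.C ((2 : ℚ_[2]) ^ m) * ιΛ (g₁ * u) =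
          PowerSeries.C ((2 : ℚ_[2]) ^ m) * (PowerSeries.C (ϖ : ℚ_[2]) * ιΛ L) := by
        calc PowerSeries.C ((2 : ℚ_[2]) ^ m) * ιΛ (g₁ * ↑u)
            = ιΛ g₁ * (PowerSeries.C ((2 : ℚ_[2]) ^ m) * ιΛ ↑u) := by rw [map_mul]; ring
          _ = ιΛ (g₁ * h) := by rw [map_mul, hιh]
          _ = PowerSeries.C ((2 : ℚ_[2]) ^ m * (ϖ : ℚ_[2])) * ιΛ L := hgh
          _ = PowerSeries.C ((2 : ℚ_[2]) ^ m) * (PowerSeries.C (ϖ : ℚ_[2]) * ιΛ L) := by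
            rw [map_mul, mul_assoc]
      exact mul_left_cancel₀ h2m key
  obtain ⟨h12, hKim⟩ := hStr W hcm hr hss ha
  exact Summit.BirchSwinnertonDyer.BirchSwinnertonDyer.Theorems.bsdp_two_of_kobayashiMainConjecture_two_of_frobeniusTrace_eq_zero
    W hmod hGZK hss.1 ha hL h12 hKim hMC

end Summit.BirchSwinnertonDyer.BirchSwinnertonDyer.Theorems
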